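import Mathlib
import Summits.KontsevichZagierPeriods.KontsevichZagierPeriods.Theorems.SoloInformedPellAbelQuarterBand
import Summits.KontsevichZagierPeriods.KontsevichZagierPeriods.Theorems.SoloInformedPellAbelCircLaw
import Summits.KontsevichZagierPeriods.KontsevichZagierPeriods.Theorems.SoloInformedPiDisc
import HarnessLib
import HarnessLib.Audit

/-!
# The quarter-turn Abel theorem for the third kind, III: the law in `P` (THEOREM XXXI′)

For a quarter-turn Pell–Abel datum `P` (`SoloInformedPellAbelQuarterForm`, `…Band`): the kill
`∫∫ ω = 0` over `(0,1)² ` (`ω = ∂_t ϑ`, `ϑ(0,·) = ϑ(1,·) = 0`) and the deformation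
`[(0,1)², ω] ∼ [(0,1), Θ(·,1) − Θ(·,0)]` (`ω = ∂_v Θ`) give, exactly as in THEOREM XXXI but with the
model curve `(1+it)²`, **`⟦[(0,1), Θ(·,1)]⟧ = ⟦[(0,1), 2/(1+t²)]⟧ = 2⟦arctan⟧`**: the total turning of
the unit `C√Δ + iB` is a quarter turn.  With `Θ(t,1) = (q₀+q₂t²)κ/(2(1−nt²))` and the residue split
`κ/(1−nt²) = ακ + 2β·Θ(·,1)` this is **THEOREM XXXI′**: for ALL representations
`Π_n = [(0,1), κ/(1−nx²)]`, `K = [(0,1), κ]`,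
`⟦Π_n⟧ = ⟦[pt,α]⟧⟦K⟧ + ⟦[pt,β]⟧⟦π⟧` in `P` (`⟦π⟧ = 4⟦arctan⟧`, `⟦[pt,2β]⟧·2⟦arctan⟧ = ⟦[pt,β]⟧⟦π⟧`),
hence `Π(n|m) = αK(m) + βπ`.  Instances: the order-4 circular and negative packets (COR XXIX.10).
-/

noncomputable section

open MeasureTheory Set Filter
open scoped Classical

open Literature.NumberTheory.Transcendental Literature.NumberTheory.Transcendental.KZ
open Literature.ModelTheory.ExponentialFields

namespace Summit.KontsevichZagierPeriods.KontsevichZagierPeriods.Theorems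

namespace SoloInformedPellAbelQuarter

variable (P : SoloInformedPellAbelQuarter)

/-- `|Θ(x,1) − Θ(x,0)| ≤ (C′/2 + 2)(√(1−x))⁻¹` on `[0,1)`. [this work] -/
theorem ends_abs_le {x : ℝ} (hx : x ∈ Ico (0:ℝ) 1) :
    |P.Th x 1 - P.Th x 0| ≤ (P.CGq / 2 + 2) * (√(1 - x))⁻¹ := by
  have hx2 : x ^ 2 < 1 := by nlinarith [hx.1, hx.2]
  obtain ⟨-, hs, -⟩ := P.kq_le hx
  obtain ⟨hC, hG⟩ := P.Gq_abs_le hx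
  have h2 : |(2 : ℝ) / (1 + x ^ 2)| ≤ 2 := by
    rw [abs_of_nonneg (by positivity)]
    exact div_le_self (by norm_num) (by nlinarith)
  have hG2 : |P.Gq x / 2| ≤ P.CGq * (√(1 - x))⁻¹ / 2 := by
    rw [abs_div, abs_two]; linarith
  rw [P.Th_one hx2, P.Th_zero]
  calc |P.Gq x / 2 - 2 / (1 + x ^ 2)| ≤ |P.Gq x / 2| + |(2 : ℝ) / (1 + x ^ 2)| := abs_sub _ _
    _ ≤ P.CGq * (√(1 - x))⁻¹ / 2 + 2 := add_le_add hG2 h2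
    _ ≤ (P.CGq / 2 + 2) * (√(1 - x))⁻¹ := by nlinarith

/-- **Deformation move.**  `[(0,1)², ψ(z₀, z₁)] ∼ [(0,1), Φ(x₀,1) − Φ(x₀,0)]` (rule 3 in `v`;
fibres opened by rule 1a). [cite: KontsevichZagier2001, §1.2] [this work] -/
theorem deformation :
    ∃ (r' : IntegralRep 2) (rd : IntegralRep 1),
      r'.domain = {z : Fin 2 → ℝ | z 0 ∈ Ioo (0:ℝ) 1 ∧ z 1 ∈ Ioo (0:ℝ) 1} ∧
      (r'.integrand = fun z => P.om (z 0) (z 1)) ∧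
      rd.domain = {x : Fin 1 → ℝ | x 0 ∈ Ioo (0:ℝ) 1} ∧
      (rd.integrand = fun x => P.Th (x 0) 1 - P.Th (x 0) 0) ∧
      of r' - of rd ∈ relations := by
  have snoc0 : ∀ (x : Fin 1 → ℝ) (c : ℝ), (Fin.snoc x c : Fin 2 → ℝ) 0 = x 0 := fun _ _ => rfl
  have snoc1 : ∀ (x : Fin 1 → ℝ) (c : ℝ), (Fin.snoc x c : Fin 2 → ℝ) 1 = c := fun _ _ => rfl
  have hl : (Fin.last 1 : Fin 2) = 1 := rfl
  obtain ⟨hB, h0sa, h1sa, hband, hmem, hsnoc⟩ := SoloInformedPellAbelCirc.base_data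
  have hBm : MeasurableSet {y : Fin 1 → ℝ | y 0 ∈ Ioo (0:ℝ) 1} :=
    IsSemialgebraic.measurableSet_holds hB
  -- semialgebraicity and integrability on the closed band
  obtain ⟨hf, hF⟩ := P.sa_deform hband fun u hu => by
    rw [hmem] at hu; exact ⟨⟨hu.1.1.le, hu.1.2⟩, hu.2.1, hu.2.2⟩
  have hint := (P.integrableOn_om hband fun u hu => by
    rw [hmem] at hu; exact ⟨hu.1, hu.2.1, hu.2.2⟩).1
  -- continuity and derivative along the fibres
  have hcont : ∀ x ∈ {y : Fin 1 → ℝ | y 0 ∈ Ioo (0:ℝ) 1},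
      ContinuousOn (fun u : ℝ => (fun w : Fin 2 → ℝ => P.Th (w 0) (w 1))
        (Fin.snoc x u)) (Icc ((fun _ : Fin 1 → ℝ => (0:ℝ)) x) ((fun _ : Fin 1 → ℝ => (1:ℝ)) x)) := by
    intro x hx
    have h : x 0 ∈ Ioo (0:ℝ) 1 := hx
    simp only [snoc0, snoc1]
    exact (P.continuousOn_potentials ⟨h.1.le, h.2.le⟩ ⟨le_rfl, zero_le_one⟩).2
  have hder : ∀ x ∈ {y : Fin 1 → ℝ | y 0 ∈ Ioo (0:ℝ) 1},
      ∀ u ∈ Ioo ((fun _ : Fin 1 → ℝ => (0:ℝ)) x) ((fun _ : Fin 1 → ℝ => (1:ℝ)) x),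
      HasDerivAt (fun u : ℝ => (fun w : Fin 2 → ℝ => P.Th (w 0) (w 1)) (Fin.snoc x u))
        ((fun w : Fin 2 → ℝ => P.om (w 0) (w 1)) (Fin.snoc x u)) u := by
    intro x hx u hu
    have h : x 0 ∈ Ioo (0:ℝ) 1 := hx
    have hu' : 0 < u ∧ u < 1 := hu
    simp only [snoc0, snoc1]
    exact P.Th_hasDerivAt ⟨h.1.le, h.2⟩ ⟨hu'.1.le, hu'.2.le⟩
  -- the boundary function `Φ(t,1) − Φ(t,0)`
  obtain ⟨hφ1, hmaps1⟩ := hsnoc 1 isAlgebraic_one ⟨zero_le_one, le_rfl⟩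
  obtain ⟨hφ0, hmaps0⟩ := hsnoc 0 isAlgebraic_zero ⟨le_rfl, zero_le_one⟩
  have hds : IsSemialgebraicFunOn ℚ {y : Fin 1 → ℝ | y 0 ∈ Ioo (0:ℝ) 1}
      (fun x => (fun w : Fin 2 → ℝ => P.Th (w 0) (w 1))
          (Fin.snoc x ((fun _ : Fin 1 → ℝ => (1:ℝ)) x)) -
        (fun w : Fin 2 → ℝ => P.Th (w 0) (w 1))
          (Fin.snoc x ((fun _ : Fin 1 → ℝ => (0:ℝ)) x))) := by
    refine (IsSemialgebraicFunOn.sub_holds (hF.comp_isSemialgebraicMapOn_holds hφ1 hmaps1)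
      (hF.comp_isSemialgebraicMapOn_holds hφ0 hmaps0)).congr fun x _ => ?_
    simp only [Pi.sub_apply, Function.comp_apply, snoc0, snoc1]
  have hsad : IsSemialgebraicFunOn ℚ {y : Fin 1 → ℝ | y 0 ∈ Ioo (0:ℝ) 1}
      (fun x => P.Th (x 0) 1 - P.Th (x 0) 0) := by
    refine hds.congr fun x _ => ?_
    simp only [snoc0, snoc1]
  have hC : 0 ≤ P.CGq / 2 + 2 := by linarith [(P.Gq_abs_le ⟨le_rfl, zero_lt_one⟩).1]
  have hdi' : IntegrableOn (fun x : Fin 1 → ℝ => P.Th (x 0) 1 - P.Th (x 0) 0)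
      {y : Fin 1 → ℝ | y 0 ∈ Ioo (0:ℝ) 1} := by
    refine soloInformed_integrableOn_of_le_inv_sqrt_prod hB hsad ∅ {0} ∅ {0} (P.CGq / 2 + 2) ∅
      measure_empty (fun x hx _ j => ?_) (fun x _ hc => ?_)
    · have h : x 0 ∈ Ioo (0:ℝ) 1 := hx
      fin_cases j
      exact h
    · have ha := hc 0
      have hP := P.ends_abs_le ⟨ha.1.le, ha.2⟩
      have hX : 0 ≤ (√(1 - x 0))⁻¹ := by positivity
      rw [Finset.prod_empty, Finset.prod_singleton, one_mul]
      exact hP.trans (by nlinarith [mul_nonneg hC hX])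
  have hdi : IntegrableOn
      (fun x => (fun w : Fin 2 → ℝ => P.Th (w 0) (w 1))
          (Fin.snoc x ((fun _ : Fin 1 → ℝ => (1:ℝ)) x)) -
        (fun w : Fin 2 → ℝ => P.Th (w 0) (w 1))
          (Fin.snoc x ((fun _ : Fin 1 → ℝ => (0:ℝ)) x)))
      {y : Fin 1 → ℝ | y 0 ∈ Ioo (0:ℝ) 1} := by
    refine hdi'.congr_fun (fun x _ => ?_) hBm
    simp only [snoc0, snoc1]
  -- Newton–Leibniz in `v`, then open the fibres
  obtain ⟨rb, rd, hrbd, hrbi, hrdd, hrdi, hrel⟩ := exists_band_newtonLeibniz hB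
    (fun _ => (0:ℝ)) (fun _ => (1:ℝ)) h0sa h1sa (fun _ _ => zero_le_one) _ _ hF hf hcont hder
    hint hds hdi
  obtain ⟨r', hr'd, hr'i, hrel'⟩ := of_sub_of_restrict_openBand_mem_relations h0sa h1sa rb hrbd
  refine ⟨r', rd, ?_, by rw [hr'i, hrbi], hrdd, ?_, ?_⟩
  · rw [hr'd]
    ext z
    simp only [mem_setOf_eq, Fin.init, Fin.castSucc_zero, hl, mem_Ioo]
  · rw [hrdi]
    funext x
    simp only [snoc0, snoc1]
  · have h := relations.sub_mem hrel hrel'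
    have e : of r' - of rd = of rb - of rd - (of rb - of r') := by abel
    rw [e]
    exact h

/-- **Kill move** (the argument form of Abel's theorem).  `[(0,1)², ψ(z₀, z₁)] ∼ 0`:
`φ(0,v) = φ(1,v) = 0`. [cite: KontsevichZagier2001, §1.2] [this work] -/
theorem killed :
    ∃ T : IntegralRep 2, of T ∈ relations ∧
      T.domain = {z : Fin 2 → ℝ | z 0 ∈ Ioo (0:ℝ) 1 ∧ z 1 ∈ Ioo (0:ℝ) 1} ∧
      (T.integrand = fun z => P.om (z 0) (z 1)) := by
  have snoc0 : ∀ (x : Fin 1 → ℝ) (c : ℝ), (Fin.snoc x c : Fin 2 → ℝ) 0 = x 0 := fun _ _ => rfl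
  have snoc1 : ∀ (x : Fin 1 → ℝ) (c : ℝ), (Fin.snoc x c : Fin 2 → ℝ) 1 = c := fun _ _ => rfl
  have hl : (Fin.last 1 : Fin 2) = 1 := rfl
  obtain ⟨hB₂, -, -, hband, hmem, -⟩ := SoloInformedPellAbelCirc.base_data
  obtain ⟨hP, hg⟩ := P.sa_swap_face hband fun u hu => by
    rw [hmem] at hu
    exact ⟨⟨hu.2.1, hu.2.2⟩, ⟨hu.1.1.le, hu.1.2.le⟩⟩
  have hint := (P.integrableOn_om hband fun u hu => by
    rw [hmem] at hu
    exact ⟨hu.1, hu.2.1, hu.2.2⟩).2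
  have hcont : ∀ y ∈ {y : Fin 1 → ℝ | y 0 ∈ Ioo (0:ℝ) 1},
      ContinuousOn (fun im : ℝ => (fun w : Fin 2 → ℝ => P.vth (w 1) (w 0)) (Fin.snoc y im))
        (Icc 0 1) := by
    intro y hy
    have h : y 0 ∈ Ioo (0:ℝ) 1 := hy
    simp only [snoc0, snoc1]
    exact (P.continuousOn_potentials ⟨le_rfl, zero_le_one⟩ ⟨h.1.le, h.2.le⟩).1
  have hder : ∀ y ∈ {y : Fin 1 → ℝ | y 0 ∈ Ioo (0:ℝ) 1}, ∀ im ∈ Ioo (0:ℝ) 1,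
      HasDerivAt (fun im : ℝ => (fun w : Fin 2 → ℝ => P.vth (w 1) (w 0)) (Fin.snoc y im))
        ((fun w : Fin 2 → ℝ => P.om (w 1) (w 0)) (Fin.snoc y im)) im := by
    intro y hy im hb
    have h : y 0 ∈ Ioo (0:ℝ) 1 := hy
    simp only [snoc0, snoc1]
    exact P.vth_hasDerivAt ⟨hb.1.le, hb.2⟩ ⟨h.1.le, h.2.le⟩
  have h0 : ∀ y ∈ {y : Fin 1 → ℝ | y 0 ∈ Ioo (0:ℝ) 1},
      (fun w : Fin 2 → ℝ => P.vth (w 1) (w 0)) (Fin.snoc y 1) -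
        (fun w : Fin 2 → ℝ => P.vth (w 1) (w 0)) (Fin.snoc y 0) = 0 := by
    intro y _
    simp only [snoc0, snoc1, (P.faces (y 0)).1, (P.faces (y 0)).2.1, sub_zero]
  have he0 : Equiv.swap (0 : Fin 2) 1 0 = 1 := by decide
  have he1 : Equiv.swap (0 : Fin 2) 1 1 = 0 := by decide
  obtain ⟨T, hTd, hTi, hT⟩ := soloInformed_kummerZeta_kill _ hB₂ _ _ hP hg hcont hder hint h0
    (Equiv.swap 0 1)
  refine ⟨T, hT, ?_, ?_⟩
  · rw [hTd]
    ext w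
    simp only [mem_setOf_eq, Fin.init, Fin.castSucc_zero, hl, he0, he1, mem_Ioo]
    constructor
    · rintro ⟨h1, h2, h3⟩; exact ⟨⟨h2, h3⟩, h1⟩
    · rintro ⟨⟨h2, h3⟩, h1⟩; exact ⟨h1, h2, h3⟩
  · rw [hTi]
    funext w
    simp only [he0, he1]

/-- **The turning of the unit equals the turning of the model `(1+it)²`**:
`[(0,1), Θ(·,1) − Θ(·,0)] ∼ 0`. [this work] -/
theorem ends_mem_relations :
    ∃ rd : IntegralRep 1, rd.domain = {x : Fin 1 → ℝ | x 0 ∈ Ioo (0:ℝ) 1} ∧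
      (rd.integrand = fun x => P.Th (x 0) 1 - P.Th (x 0) 0) ∧ of rd ∈ relations := by
  obtain ⟨r', rd, hr'd, hr'i, hrdd, hrdi, hdef⟩ := P.deformation
  obtain ⟨T, hT, hTd, hTi⟩ := P.killed
  have hrT : of r' - of T ∈ relations :=
    of_sub_of_mem_relations_of_eqOn (by rw [hTd, hr'd]) fun z _ => by rw [hr'i, hTi]
  have hr' : of r' ∈ relations := by
    have h := relations.add_mem hrT hT
    simpa using h
  refine ⟨rd, hrdd, hrdi, ?_⟩
  have h := relations.sub_mem hr' hdef
  simpa using h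

/-- **The argument principle in `P`, quarter turn**: a representation `[(0,1), Θ(·,1)]` of half
the angular derivative of the unit exists and its class is `2⟦arctan⟧` (`= ⟦π⟧/2` in values:
`⟦[(0,1), Θ(·,1)]⟧ = ⟦[(0,1), 2/(1+t²)]⟧ = 2⟦arctan⟧`). [this work] -/
theorem turning_eq_two_arctan :
    ∃ Gr : IntegralRep 1, Gr.domain = {x : Fin 1 → ℝ | x 0 ∈ Ioo (0:ℝ) 1} ∧
      (Gr.integrand = fun x => P.Th (x 0) 1) ∧
      toFormalPeriod (of Gr) = 2 • toFormalPeriod (of soloInformedArctanRep) := by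
  have snoc0 : ∀ (x : Fin 1 → ℝ) (c : ℝ), (Fin.snoc x c : Fin 2 → ℝ) 0 = x 0 := fun _ _ => rfl
  have snoc1 : ∀ (x : Fin 1 → ℝ) (c : ℝ), (Fin.snoc x c : Fin 2 → ℝ) 1 = c := fun _ _ => rfl
  obtain ⟨hB, -, -, hband, hmem, hsnoc⟩ := SoloInformedPellAbelCirc.base_data
  obtain ⟨rd, hrdd, hrdi, hrd⟩ := P.ends_mem_relations
  -- the model end as a restriction of `2·[arctan]`
  have hsub : {x : Fin 1 → ℝ | x 0 ∈ Ioo (0:ℝ) 1} ⊆ soloInformedUnitI := fun x hx =>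
    ⟨le_of_lt (show x 0 ∈ Ioo (0:ℝ) 1 from hx).1, le_of_lt (show x 0 ∈ Ioo (0:ℝ) 1 from hx).2⟩
  set A2 : IntegralRep 1 := soloInformedArctanRep.constMul ((2 : ℕ) : ℝ) (isAlgebraic_nat 2) with hA2
  have hA2d : A2.domain = soloInformedUnitI := rfl
  set A0 : IntegralRep 1 := A2.restrict {x : Fin 1 → ℝ | x 0 ∈ Ioo (0:ℝ) 1} hB
    (by rw [hA2d]; exact hsub) with hA0
  have hA0i : ∀ x, A0.integrand x = 2 * (1 / (1 + x 0 ^ 2)) := fun x => by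
    simp [hA0, hA2, IntegralRep.restrict]
  have hvol : volume (A2.domain \ {x : Fin 1 → ℝ | x 0 ∈ Ioo (0:ℝ) 1}) = 0 := by
    rw [hA2d]
    refine measure_mono_null (fun x hx => ?_)
      (measure_union_null (BallPeeling.volume_setOf_apply_eq_const 1 0 0)
        (BallPeeling.volume_setOf_apply_eq_const 1 0 1))
    have h1 : 0 ≤ x 0 ∧ x 0 ≤ 1 := hx.1
    have h2 : ¬ (0 < x 0 ∧ x 0 < 1) := hx.2
    simp only [mem_union, mem_setOf_eq]
    rcases h1.1.eq_or_lt with h | h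
    · exact Or.inl h.symm
    · rcases h1.2.lt_or_eq with h' | h'
      · exact absurd ⟨h, h'⟩ h2
      · exact Or.inr h'
  have hA20 : of A2 - of A0 ∈ relations := IntegralRep.of_sub_of_restrict_mem_relations A2 hB _ hvol
  -- the unit end `[(0,1), Φ(·,1)]`
  obtain ⟨-, hF⟩ := P.sa_deform hband fun u hu => by
    rw [hmem] at hu; exact ⟨⟨hu.1.1.le, hu.1.2⟩, hu.2.1, hu.2.2⟩
  obtain ⟨hφ1, hmaps1⟩ := hsnoc 1 isAlgebraic_one ⟨zero_le_one, le_rfl⟩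
  have hsaG : IsSemialgebraicFunOn ℚ {y : Fin 1 → ℝ | y 0 ∈ Ioo (0:ℝ) 1} (fun x => P.Th (x 0) 1) := by
    refine (hF.comp_isSemialgebraicMapOn_holds hφ1 hmaps1).congr fun x _ => ?_
    simp only [Function.comp_apply, snoc0, snoc1]
  have hC := (P.Gq_abs_le ⟨le_rfl, zero_lt_one⟩).1
  have hdiG : IntegrableOn (fun x : Fin 1 → ℝ => P.Th (x 0) 1) {y : Fin 1 → ℝ | y 0 ∈ Ioo (0:ℝ) 1} := by
    refine soloInformed_integrableOn_of_le_inv_sqrt_prod hB hsaG ∅ {0} ∅ {0} P.CGq ∅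
      measure_empty (fun x hx _ j => ?_) (fun x _ hc => ?_)
    · have h : x 0 ∈ Ioo (0:ℝ) 1 := hx
      fin_cases j
      exact h
    · have ha := hc 0
      have hP := (P.Gq_abs_le ⟨ha.1.le, ha.2⟩).2
      have hX : 0 ≤ P.CGq * (√(1 - x 0))⁻¹ := by positivity
      rw [Finset.prod_empty, Finset.prod_singleton, one_mul,
        P.Th_one (by nlinarith [ha.1, ha.2] : x 0 ^ 2 < 1), abs_div, abs_two]
      calc |P.Gq (x 0)| / 2 ≤ P.CGq * (√(1 - x 0))⁻¹ := by linarith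
        _ ≤ P.CGq * ((√(1 - x 0))⁻¹ + (√(1 - x 0))⁻¹) := by nlinarith
  let Gr : IntegralRep 1 := ⟨{y : Fin 1 → ℝ | y 0 ∈ Ioo (0:ℝ) 1}, fun x => P.Th (x 0) 1, hB, hsaG, hdiG⟩
  -- rule 1b: `Θ(x,1) = (Θ(x,1) − Θ(x,0)) + 2/(1+x²)`
  have hrel : of Gr - of rd - of A0 ∈ relations := by
    refine integrandAddRel_subset_relations ⟨1, Gr, rd, A0, hrdd, rfl, fun x _ => ?_, rfl⟩
    simp only [Pi.add_apply, hrdi, hA0i, P.Th_zero]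
    ring
  refine ⟨Gr, rfl, rfl, ?_⟩
  have t1 := toFormalPeriod_eq_zero_of_mem hrel
  have t2 := toFormalPeriod_eq_zero_of_mem hrd
  have t3 := toFormalPeriod_eq_zero_of_mem hA20
  have t4 := toFormalPeriod_eq_zero_of_mem
    (soloInformedArctanRep.of_constMul_nat_sub_nsmul_mem_relations 2)
  rw [map_sub, map_sub] at t1
  rw [map_sub, sub_eq_zero] at t3 t4
  rw [map_nsmul] at t4
  have e1 : toFormalPeriod (of Gr) = toFormalPeriod (of A0) := by linear_combination t1 + t2
  rw [e1, ← t3]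
  exact t4

end SoloInformedPellAbelQuarter

/-! ### THEOREM XXXI′ -/

/-- `⟦[pt, 2β]⟧ · 2⟦arctan⟧ = ⟦[pt, β]⟧ · ⟦π⟧` (`⟦[pt,2β]⟧ = 2⟦[pt,β]⟧`, `⟦π⟧ = 4⟦arctan⟧`).
[this work] -/
theorem SoloInformedPellAbelQuarter.two_beta_turning (P : SoloInformedPellAbelQuarter) :
    toFormalPeriod (of (IntegralRep.unit.constMul (2 * P.beta) P.alpha_beta_isAlgebraic.2.1)) *
        (2 • toFormalPeriod (of soloInformedArctanRep)) =
      toFormalPeriod (of (IntegralRep.unit.constMul P.beta P.alpha_beta_isAlgebraic.2.2)) *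
        toFormalPeriod (of piRep) := by
  have hβ := P.alpha_beta_isAlgebraic.2.2
  have hβ2 := P.alpha_beta_isAlgebraic.2.1
  have h2 : IsAlgebraic ℚ (((2 : ℕ) : ℝ)) := isAlgebraic_nat 2
  have e2 : ((2 : ℕ) : ℝ) * P.beta = 2 * P.beta := by norm_num
  have hβ2' : IsAlgebraic ℚ (((2 : ℕ) : ℝ) * P.beta) := by rw [e2]; exact hβ2
  have t5 := toFormalPeriod_eq_zero_of_mem soloInformed_piRep_sub_four_nsmul_arctanRep_mem_relations
  have t6 := toFormalPeriod_eq_zero_of_mem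
    ((IntegralRep.unit.constMul P.beta hβ).of_constMul_nat_sub_nsmul_mem_relations 2)
  rw [map_sub, sub_eq_zero, map_nsmul] at t5 t6
  rw [toFormalPeriod_of_constMul _ h2, soloInformed_pointRep_mul _ _ h2 hβ hβ2',
    soloInformed_pointRep_congr hβ2' hβ2 e2] at t6
  rw [t5, t6, smul_mul_assoc, mul_smul_comm, mul_smul_comm, smul_smul]
  norm_num

/-- **THEOREM XXXI′ (the quarter-turn Abel theorem for the third kind, in `P`).**  For every
quarter-turn Pell–Abel datum `P` and ALL representations `Π_n = [(0,1), κ_m/(1−nx²)]`,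
`K = [(0,1), κ_m]`: `⟦Π_n⟧ = ⟦[pt, α]⟧·⟦K⟧ + ⟦[pt, β]⟧·⟦π⟧` in `P`, `α = q₂/(q₂ + nq₀)`,
`β = n/(q₂ + nq₀)`. [this work] -/
theorem soloInformed_pellAbelQuarter_law (P : SoloInformedPellAbelQuarter) (PN K : IntegralRep 1)
    (hPNd : PN.domain = {x | x 0 ∈ Ioo (0:ℝ) 1})
    (hPNi : EqOn PN.integrand (fun x => (1 - P.n * x 0 ^ 2)⁻¹ *
      ((√(1 - x 0 ^ 2))⁻¹ * (√(1 - P.m * x 0 ^ 2))⁻¹)) PN.domain)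
    (hKd : K.domain = {x | x 0 ∈ Ioo (0:ℝ) 1})
    (hKi : EqOn K.integrand (fun x => (√(1 - x 0 ^ 2))⁻¹ * (√(1 - P.m * x 0 ^ 2))⁻¹) K.domain) :
    toFormalPeriod (of PN) =
      toFormalPeriod (of (IntegralRep.unit.constMul P.alpha P.alpha_beta_isAlgebraic.1)) *
        toFormalPeriod (of K) +
      toFormalPeriod (of (IntegralRep.unit.constMul P.beta P.alpha_beta_isAlgebraic.2.2)) *
        toFormalPeriod (of piRep) := by
  have hα := P.alpha_beta_isAlgebraic.1
  have hβ2 := P.alpha_beta_isAlgebraic.2.1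
  obtain ⟨Gr, hGd, hGi, hGr⟩ := P.turning_eq_two_arctan
  -- rule 1b with the split `κ/(1−nt²) = ακ + 2β·Θ(·,1)` on `(0,1)`
  have hrel : of PN - of (K.constMul _ hα) - of (Gr.constMul _ hβ2) ∈ relations := by
    refine integrandAddRel_subset_relations ⟨1, PN, K.constMul _ hα, Gr.constMul _ hβ2,
      by rw [IntegralRep.domain_constMul, hKd, hPNd], by rw [IntegralRep.domain_constMul, hGd, hPNd],
      fun x hx => ?_, rfl⟩
    have hxK : x ∈ K.domain := by rw [hKd, ← hPNd]; exact hx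
    have hx' : x 0 ∈ Ioo (0:ℝ) 1 := by rw [hPNd] at hx; exact hx
    have ht2 : x 0 ^ 2 < 1 := by nlinarith [hx'.1, hx'.2]
    have hD : 1 - P.n * x 0 ^ 2 ≠ 0 := (P.one_sub_n_pos ht2.le).ne'
    simp only [Pi.add_apply, IntegralRep.integrand_constMul, hGi, hPNi hx, hKi hxK,
      P.Th_one ht2, SoloInformedPellAbelQuarter.Gq, SoloInformedPellAbelQuarter.kq]
    rw [P.alpha_split ht2.le]
    field_simp
    ring
  have t1 : toFormalPeriod (of PN) - toFormalPeriod (of (K.constMul _ hα)) =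
      toFormalPeriod (of (Gr.constMul _ hβ2)) := by
    rw [← map_sub]
    exact toFormalPeriod_eq_iff.mpr hrel
  rw [sub_eq_iff_eq_add.mp t1, toFormalPeriod_of_constMul _ hβ2 Gr, hGr, P.two_beta_turning,
    toFormalPeriod_of_constMul _ hα K]
  exact add_comm _ _

/-- **THEOREM XXXI′ in values**: `Π(n | m) = α·K(m) + β·π`. [this work] -/
theorem soloInformed_pellAbelQuarter_law_value (P : SoloInformedPellAbelQuarter) (PN K : IntegralRep 1)
    (hPNd : PN.domain = {x | x 0 ∈ Ioo (0:ℝ) 1})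
    (hPNi : EqOn PN.integrand (fun x => (1 - P.n * x 0 ^ 2)⁻¹ *
      ((√(1 - x 0 ^ 2))⁻¹ * (√(1 - P.m * x 0 ^ 2))⁻¹)) PN.domain)
    (hKd : K.domain = {x | x 0 ∈ Ioo (0:ℝ) 1})
    (hKi : EqOn K.integrand (fun x => (√(1 - x 0 ^ 2))⁻¹ * (√(1 - P.m * x 0 ^ 2))⁻¹) K.domain) :
    PN.value = P.alpha * K.value + P.beta * Real.pi := by
  have h := congrArg evalP (soloInformed_pellAbelQuarter_law P PN K hPNd hPNi hKd hKi)
  simpa only [map_mul, map_add, evalP_toFormalPeriod_of, IntegralRep.value_constMul,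
    IntegralRep.value_unit, mul_one, piRep_value] using h

/-- **The two representations exist**, and satisfy the law. [this work] -/
theorem soloInformed_pellAbelQuarter_law_exists (P : SoloInformedPellAbelQuarter) :
    ∃ PN K : IntegralRep 1,
      PN.domain = {x | x 0 ∈ Ioo (0:ℝ) 1} ∧
      (∀ x, PN.integrand x = (1 - P.n * x 0 ^ 2)⁻¹ *
        ((√(1 - x 0 ^ 2))⁻¹ * (√(1 - P.m * x 0 ^ 2))⁻¹)) ∧
      K.domain = {x | x 0 ∈ Ioo (0:ℝ) 1} ∧
      (∀ x, K.integrand x = (√(1 - x 0 ^ 2))⁻¹ * (√(1 - P.m * x 0 ^ 2))⁻¹) ∧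
      PN.value = P.alpha * K.value + P.beta * Real.pi := by
  have hm := P.m_mem
  obtain ⟨PN, hPNd, hPNi⟩ := soloInformed_exists_ellipticPi_rep_of_lt_one _ _ P.n_lt P.n_isAlgebraic
    hm P.m_isAlgebraic
  obtain ⟨K, hKd, hKi⟩ := soloInformed_exists_ellipticK_rep _ hm P.m_isAlgebraic
  exact ⟨PN, K, hPNd, hPNi, hKd, hKi, soloInformed_pellAbelQuarter_law_value P PN K hPNd
    (fun x _ => hPNi x) hKd (fun x _ => hKi x)⟩

end Summit.KontsevichZagierPeriods.KontsevichZagierPeriods.Theorems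

end
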